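import Summits.Ventures.PercRepro.C026PFunTree
import Summits.Ventures.PercRepro.C026PFunLeafRec

/-!
# Pieces: the components away from the probe factor out (p6, gen 16; mine-3 §28 «PIECES»)

If the edge set splits as `F ∪ F'` with `F` and `F'` vertex-disjoint and `F'` not touching the
probe, then `ρ·(P_{F ∪ F'}) = (∑_{ω' ⊆ F'} n̄(ω'))·(P_F)` (`pFun_union_pieces`): the configurations of
`F'` contribute only their `n̄`-factor, whatever `F'` is.  Hence `(P) ≥ 0` on every skeleton whose
component of the probe is a tree (`IsTree.pFun_nonneg_union`) — in particular on every forest.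
-/

namespace PercRepro

namespace MultiGraph

open Finset

variable {V E : Type*} [Fintype V] [DecidableEq V] [Fintype E] [DecidableEq E] {G : MultiGraph V E}

/-- **The pieces factor out**: `ρ·(P_{F ∪ F'}) = n̂(F')·(P_F)` for vertex-disjoint `F`, `F'` with `F'`
not touching the probe `c`. -/
theorem pFun_union_pieces {F F' : Finset E} (hd : G.VDisjoint F F') {c : V}
    (hc : ¬ G.Touches F' c) (x K : V → ℝ) :
    rhoAll x * G.pFun c x K (F ∪ F') = G.nSum x F' * G.pFun c x K F := by
  unfold pFun
  rw [sum_configsIn_union hd.disjoint, Finset.mul_sum, mul_comm (G.nSum x F'), Finset.sum_mul]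
  refine Finset.sum_congr rfl fun ω₀ h₀ => ?_
  have h₀' : complIn F ω₀ ∈ configsIn F := complIn_mem_configsIn F ω₀
  have hX : ∀ ω₁ ∈ configsIn F', G.xCluster x c (join ω₀ ω₁) = G.xCluster x c ω₀ := fun ω₁ h₁ => by
    unfold xCluster
    rw [clusterF_join_left hd h₀ h₁ hc]
  have hK : ∀ ω₁ ∈ configsIn F', G.kCluster K c (join ω₀ ω₁) = G.kCluster K c ω₀ := fun ω₁ h₁ => by
    unfold kCluster
    rw [clusterF_join_left hd h₀ h₁ hc]
  -- termwise: ρ·[N_c(join)(1 − 2X_c) + K_c n̄(join^c)] = N_c(ω₀)(1 − 2X_c(ω₀))·n̄(ω₁) + K_c(ω₀)n̄(ω₀^c)·n̄(ω₁^c)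
  have hterm : ∀ ω₁ ∈ configsIn F',
      rhoAll x * (G.nbarOff x c (join ω₀ ω₁) * (1 - 2 * G.xCluster x c (join ω₀ ω₁)) +
        G.kCluster K c (join ω₀ ω₁) * G.nbar x (complIn (F ∪ F') (join ω₀ ω₁))) =
      G.nbarOff x c ω₀ * (1 - 2 * G.xCluster x c ω₀) * G.nbar x ω₁ +
        G.kCluster K c ω₀ * G.nbar x (complIn F ω₀) * G.nbar x (complIn F' ω₁) := by
    intro ω₁ h₁
    have h₁' : complIn F' ω₁ ∈ configsIn F' := complIn_mem_configsIn F' ω₁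
    rw [hX ω₁ h₁, hK ω₁ h₁, complIn_union_join hd.disjoint h₀ h₁]
    have hN := nbarOff_join hd h₀ h₁ x hc
    have hn := nbar_join hd h₀' h₁' x
    linear_combination (1 - 2 * G.xCluster x c ω₀) * hN + G.kCluster K c ω₀ * hn
  rw [Finset.mul_sum, Finset.sum_congr rfl hterm, Finset.sum_add_distrib, ← Finset.mul_sum,
    ← Finset.mul_sum, sum_complIn_eq F' (fun ω₁ => G.nbar x ω₁)]
  unfold nSum
  ring

/-- **(P) ≥ 0 when the probe's component is a tree** (forests in particular): `F` a tree at `c`,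
`F'` arbitrary, vertex-disjoint from `F` and not touching `c`. -/
theorem IsTree.pFun_nonneg_union {c : V} {F F' : Finset E} (h : IsTree G c F)
    (hd : G.VDisjoint F F') (hc : ¬ G.Touches F' c) {x K : V → ℝ} (hx : ∀ v, 0 ≤ x v ∧ x v ≤ 1)
    (hK : ∀ v, kMin (x v) ≤ K v) : 0 ≤ G.pFun c x K (F ∪ F') := by
  have hρ : 0 < rhoAll x := by linarith [one_le_rhoAll (V := V) hx]
  have hn : 0 ≤ G.nSum x F' := Finset.sum_nonneg fun ω _ => nbar_nonneg hx ω
  have := pFun_union_pieces (G := G) hd hc x K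
  have hpos : 0 ≤ rhoAll x * G.pFun c x K (F ∪ F') := by
    rw [this]
    exact mul_nonneg hn (h.pFun_nonneg hx hK)
  exact nonneg_of_mul_nonneg_right hpos hρ

/-- **The cycle version of THEOREM R (mine-3 §29 (c))**: a cycle through the probe is a one-ended
path `F` from `c` closed by one more edge `e`; if `(P_{F + e}) ≥ (P_F)` at every lower-corner state
(EM(corner) at the closing edge), then `(P_{F + e}) ≥ 0` at every band state — the path pays by
THEOREM T for one-ended paths. -/
theorem ProbePath.pFun_nonneg_insert_of_emCorner {c : V} {F : Finset E} (hp : ProbePath G c F)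
    {e : E} (he : e ∉ F)
    (hEM : ∀ x : V → ℝ, (∀ v, 0 ≤ x v ∧ x v ≤ 1) →
      G.pFun c x (fun v => kMin (x v)) F ≤ G.pFun c x (fun v => kMin (x v)) (insert e F))
    {x K : V → ℝ} (hx : ∀ v, 0 ≤ x v ∧ x v ≤ 1) (hK : ∀ v, kMin (x v) ≤ K v) :
    0 ≤ G.pFun c x K (insert e F) := by
  refine pFun_nonneg_of_emCorner_at (Finset.mem_insert_self e F) ?_ ?_ hx hK
  · intro x K hx hK
    rw [Finset.erase_insert he]
    exact hp.pFun_nonneg x K hx hK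
  · intro x hx
    rw [Finset.erase_insert he]
    exact hEM x hx


end MultiGraph

end PercRepro
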